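import Mathlib
import Summits.ValiantsHypothesis.ValiantsHypothesis.Theorems.FifoMatchingNNDivisionHardLowDimRung
import HarnessLib

/-!
# ★ The PARALLEL-FLATS RUNG for `COR(n) + Q` — ONE counting mechanism containing both PROP A (generator COUNT) and the
# DIMENSION RUNG (crux `Theses.FifoMatching.NNDivisionHard`, stmt-ValiantsHypothesis-21181; COR level)

WHAT IS NEW.  The tree decides a Minkowski passenger `Q = conv{q j}` of `COR(K_h)` by two INCOMPARABLE certificates:
PROP A / the chamber certificate (✓ `…XcDivisionChamberCertificate.corPolytopeGraph_top_add_hull_three_pow_le`: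
`3^h ≤ K·(r+1)·2^h`, `K` = number of generators) and the DIMENSION RUNG (✓ `…LowDimRung.corPolytopeGraph_top_add_hull_three_pow_le_of_finrank`:
`3^{h−d} ≤ (r+1)·2^{h−d}`, `d = dim aff Q`).  This file proves the common generalisation, with ONE certificate:

* ★ `corPolytope_add_genericFace_three_pow_le_card` — the EXPOSURE RUNG WITH A COUNT: if the generators are labelled `π : J → T`
  and two generators WITH THE SAME LABEL coincide as soon as they agree on every test functional of the face `F_{S,S'}` (and on
  its diagonal direction), then `3^m ≤ |T|·(r+1)·2^m` (`m` indices outside `S ∪ S'`): a generic functional in the normal cone of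
  `F_{S,S'}` exposes `F_{S,S'} + F_Q` where the top generators `F_Q ∩ {q j}` take AT MOST `|T|` distinct values, and the chamber
  pigeonhole (`three_pow_le_of_add`) charges them.
* ★★ `corPolytope_add_three_pow_le_of_flats` / `corPolytopeGraph_top_add_hull_three_pow_le_of_flats` — the PARALLEL-FLATS RUNG:
  if the generators lie on `|T|` PARALLEL TRANSLATES of a direction space `V` (`q j − q j' ∈ V` whenever `π j = π j'`), then
  `3^{h − dim V} ≤ |T|·(r+1)·2^{h − dim V}` (FLAG LEMMA `faceKer_flag_iterate` kills `V` with `dim V` prescribed indices, then the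
  rung above).  `V = 0`: PROP A.  `|T| = 1`: the DIMENSION RUNG.  New members: passengers with exponentially many generators AND
  large dimension, e.g. `Q = Q₁ + Q₂` with `Q₁` few-generated and `Q₂` low-dimensional (`add_flats`), neither certificate alone applying.
The route rate (`corMinkowskiHard_fewFlats`) and the NN-currency reading (cofactors `p·q` with `p` few-nomial and `q`
low-dimensional — neither tier alone decides them) are the sibling file `…NNDivisionHardFewFlatsExp`.

MECHANISM: the exposure rung's genericity (`exists_generic_comb`, `exists_large_avoid`, the test family `psi`, FMPTW data `ud_data`)
VERBATIM from ✓ `…LowDimExposure` (val-idea-40 / port val-port-1), with the separation bookkeeping relativised to the labelling `π`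
and the one-point face replaced by the finset of top values; then ✓ `three_pow_le_of_add`.  No definitions, no named facts, no sorry.

HONEST FRAMING: a certificate for a CLASS of passengers (restriction of COR-MINKOWSKI / COR-VIRTUAL) — the survivors are passengers
whose generators need exponentially many parallel low-dimensional flats (fan-saturating zonotopes, dense towers); stmt-21181
`NNDivisionHard` OPEN; COR-MINKOWSKI / COR-VIRTUAL OPEN; `NNNotVP` OPEN; `VP ≠ VNP` NOT proved; nothing here is a summit statement.
References: Fiorini–Massar–Pokutta–Tiwary–de Wolf 2015 Lemma 6, Thm 7 [FioriniEtAl2015]; Kaibel–Weltge 2015 Thm 1 [KaibelWeltge2014];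
Hrubeš–Yehudayoff 2021 §6 Problem 2 [HrubesYehudayoff2021].
-/

set_option autoImplicit false

-- the mandated summit-side namespace repeats a component by design (single-problem summit)
set_option linter.dupNamespace false

noncomputable section

open Matrix Finset
open scoped Pointwise

namespace Summit.ValiantsHypothesis.ValiantsHypothesis.Theorems.FifoMatching

namespace FewFlats

open Literature.Barriers.PneNP (HasEFOfSize)
open Literature.Combinatorics.Optimization (corPolytopeGraph)
open Literature.Combinatorics.Optimization.FixedSizePsdRank (Cube vecOuter bvec corPolytope flat
  flat_dotProduct_vecOuter)
open Summit.ValiantsHypothesis.ValiantsHypothesis.Theorems.FifoMatching.XcDivision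
open Summit.ValiantsHypothesis.ValiantsHypothesis.Theorems.FifoMatching.LowDim

/-! ## §1 The EXPOSURE RUNG WITH A COUNT -/

/-- ★ **EXPOSURE RUNG WITH A COUNT.**  If `COR(n) + Q` has an extended formulation of size `r`, `Q = conv{q j}` (up to the
usual sandwich), the generators are labelled by `π : J → T`, `S, S'` are disjoint with `m` indices `e` outside both, and two
generators WITH THE SAME LABEL that agree on every test functional of the face `F_{S,S'}` and on its diagonal direction are
equal, then `3^m ≤ |T| · (r + 1) · 2^m`: a generic functional `M·(E_S − E_{S'}) + Σ_t ε_t ψ_t` in the normal cone of `F_{S,S'}`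
exposes `F_{S,S'} + F_Q`, the top generators take at most `|T|` distinct values, and the chamber pigeonhole charges them.
(`|T| = 1`: the exposure rung of `…LowDimExposure`.) [cite: FioriniEtAl2015, Lemma 6] [cite: KaibelWeltge2014, Thm. 1] -/
theorem corPolytope_add_genericFace_three_pow_le_card {n m r : ℕ} {Q : Set (Fin (n * n) → ℝ)}
    (h : HasEFOfSize (corPolytope n + Q) r) {J T : Type} [Fintype J] [Nonempty J] [DecidableEq J]
    [Fintype T] [DecidableEq T]
    (q : J → (Fin (n * n) → ℝ)) (hq : ∀ j, q j ∈ Q) (hQ : Q ⊆ convexHull ℝ (Set.range q)) (π : J → T)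
    (S S' : Finset (Fin n)) (hSS' : Disjoint S S') (e : Fin m ↪ Fin n) (heS : ∀ i, e i ∉ S)
    (heS' : ∀ i, e i ∉ S')
    (hsep : ∀ j j', π j = π j' → (∀ t, psi S S' t ⬝ᵥ (q j - q j') = 0) →
      diagDir S S' ⬝ᵥ (q j - q j') = 0 → q j = q j') :
    3 ^ m ≤ Fintype.card T * (r + 1) * 2 ^ m := by
  classical
  obtain ⟨pt_mem, cc_valid, slack, diag_pt⟩ := ud_data n
  -- (1) a generic combination of the tests, separating every pair SOME test sees
  let BAD : Finset (J × J) := Finset.univ.filter fun jj =>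
    (∃ t, psi S S' t ⬝ᵥ (q jj.1 - q jj.2) ≠ 0) ∨ diagDir S S' ⬝ᵥ (q jj.1 - q jj.2) ≠ 0
  obtain ⟨ε, hε⟩ := exists_generic_comb (K := Bool × Fin n × Fin n) BAD
    (fun t (jj : J × J) => psi S S' t ⬝ᵥ (q jj.1 - q jj.2))
  let ev : Fin (n * n) → ℝ := ∑ t, ε t • psi S S' t
  have hev : ∀ x, ev ⬝ᵥ x = ∑ t, ε t * (psi S S' t ⬝ᵥ x) := by
    intro x
    simp only [ev, sum_dotProduct, smul_dotProduct, smul_eq_mul]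
  -- (2) the dominant diagonal part, avoiding the remaining coincidences
  have hpairs : ∀ p ∈ BAD.image (fun jj => (diagDir S S' ⬝ᵥ (q jj.1 - q jj.2), ev ⬝ᵥ (q jj.1 - q jj.2))),
      p.1 ≠ 0 ∨ p.2 ≠ 0 := by
    intro p hp
    obtain ⟨jj, hjj, rfl⟩ := Finset.mem_image.1 hp
    rcases (Finset.mem_filter.1 hjj).2 with ht | hd
    · right
      have hne := hε jj hjj ht
      rw [← hev] at hne
      exact hne
    · exact Or.inl hd
  obtain ⟨M, hMC, hM⟩ := exists_large_avoid _ hpairs (2 * ∑ t, |ε t|)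
  set w : Fin (n * n) → ℝ := M • diagDir S S' + ev with hw
  have hwdot : ∀ x, w ⬝ᵥ x = M * (diagDir S S' ⬝ᵥ x) + ev ⬝ᵥ x := by
    intro x; rw [hw, add_dotProduct, smul_dotProduct, smul_eq_mul]
  -- `w` separates every pair some test sees
  have hwsep : ∀ j j', w ⬝ᵥ q j = w ⬝ᵥ q j' →
      (∀ t, psi S S' t ⬝ᵥ (q j - q j') = 0) ∧ diagDir S S' ⬝ᵥ (q j - q j') = 0 := by
    intro j j' heq
    by_contra hcon
    have hbad : (j, j') ∈ BAD := by
      refine Finset.mem_filter.2 ⟨Finset.mem_univ _, ?_⟩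
      by_cases hd : diagDir S S' ⬝ᵥ (q j - q j') = 0
      · left
        by_contra hall
        push Not at hall
        exact hcon ⟨hall, hd⟩
      · exact Or.inr hd
    have hmem : (diagDir S S' ⬝ᵥ (q j - q j'), ev ⬝ᵥ (q j - q j')) ∈
        BAD.image (fun jj => (diagDir S S' ⬝ᵥ (q jj.1 - q jj.2), ev ⬝ᵥ (q jj.1 - q jj.2))) :=
      Finset.mem_image.2 ⟨(j, j'), hbad, rfl⟩
    have hne' := hM _ hmem
    apply hne'
    show diagDir S S' ⬝ᵥ (q j - q j') * M + ev ⬝ᵥ (q j - q j') = 0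
    have h1 : w ⬝ᵥ (q j - q j') = 0 := by rw [dotProduct_sub, heq, sub_self]
    rw [hwdot] at h1
    linarith
  -- (3) values on the vertices of `COR(n)`
  have hdiag : ∀ b : Finset (Fin n),
      diagDir S S' ⬝ᵥ udPt b = ((S ∩ b).card : ℝ) - ((S' ∩ b).card : ℝ) := by
    intro b
    rw [diagDir, diag_pt]
    have hσ : ∀ i, (if i ∈ S then (1 : ℝ) else if i ∈ S' then -1 else 0) =
        (if i ∈ S then (1 : ℝ) else 0) - (if i ∈ S' then 1 else 0) := by
      intro i
      by_cases h1 : i ∈ S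
      · have h2 : i ∉ S' := Finset.disjoint_left.1 hSS' h1
        simp [h1, h2]
      · by_cases h2 : i ∈ S' <;> simp [h1, h2]
    simp_rw [hσ]
    rw [Finset.sum_sub_distrib, Finset.sum_boole, Finset.sum_boole, Finset.filter_mem_eq_inter,
      Finset.filter_mem_eq_inter, Finset.inter_comm b S, Finset.inter_comm b S']
  have hdiag_face : ∀ b : Finset (Fin n), S ⊆ b → Disjoint S' b →
      diagDir S S' ⬝ᵥ udPt b = S.card := by
    intro b hSb hS'b
    rw [hdiag b, Finset.inter_eq_left.2 hSb, Finset.disjoint_iff_inter_eq_empty.1 hS'b,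
      Finset.card_empty]
    simp
  have hdiag_off : ∀ b : Finset (Fin n), ¬ (S ⊆ b ∧ Disjoint S' b) →
      diagDir S S' ⬝ᵥ udPt b ≤ S.card - 1 := by
    intro b hb
    rw [hdiag b]
    by_cases hSb : S ⊆ b
    · have hS'b : ¬ Disjoint S' b := fun h' => hb ⟨hSb, h'⟩
      obtain ⟨i, hi⟩ := Finset.not_disjoint_iff_nonempty_inter.1 hS'b
      have h2 : (1 : ℝ) ≤ (S' ∩ b).card := by exact_mod_cast Finset.card_pos.2 ⟨i, hi⟩
      have h1 : ((S ∩ b).card : ℝ) ≤ S.card := by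
        exact_mod_cast Finset.card_le_card Finset.inter_subset_left
      linarith
    · have hlt : (S ∩ b).card < S.card := by
        apply Finset.card_lt_card
        refine ⟨Finset.inter_subset_left, fun hsub => hSb ?_⟩
        exact fun i hi => (Finset.mem_inter.1 (hsub hi)).2
      have h1 : ((S ∩ b).card : ℝ) + 1 ≤ S.card := by exact_mod_cast hlt
      have h2 : (0 : ℝ) ≤ (S' ∩ b).card := by positivity
      linarith
  have hev_le : ∀ b : Finset (Fin n), |ev ⬝ᵥ udPt b| ≤ ∑ t, |ε t| := by
    intro b
    rw [hev]
    refine (Finset.abs_sum_le_sum_abs _ _).trans ?_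
    refine Finset.sum_le_sum fun t _ => ?_
    rw [abs_mul]
    exact mul_le_of_le_one_right (abs_nonneg _) (psi_abs_le S S' t b)
  have hev_face : ∀ b : Finset (Fin n), S ⊆ b → Disjoint S' b → ev ⬝ᵥ udPt b = ev ⬝ᵥ udPt S := by
    intro b hSb hS'b
    rw [hev, hev]
    exact Finset.sum_congr rfl fun t _ => by rw [psi_face S S' hSS' t b hSb hS'b]
  set δP : ℝ := M * S.card + ev ⬝ᵥ udPt S with hδP
  have hMpos : 0 ≤ M := by
    have : (0 : ℝ) ≤ 2 * ∑ t, |ε t| := by positivity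
    linarith
  have hw_vert : ∀ b : Finset (Fin n), w ⬝ᵥ udPt b ≤ δP := by
    intro b
    rw [hwdot]
    by_cases hb : S ⊆ b ∧ Disjoint S' b
    · rw [hdiag_face b hb.1 hb.2, hev_face b hb.1 hb.2]
    · have h1 := hdiag_off b hb
      have h2 := hev_le b
      have h3 := hev_le S
      rw [abs_le] at h2 h3
      have h4 : M * (diagDir S S' ⬝ᵥ udPt b) ≤ M * ((S.card : ℝ) - 1) :=
        mul_le_mul_of_nonneg_left h1 hMpos
      linarith [h2.2, h3.1]
  have hw_face : ∀ b : Finset (Fin n), S ⊆ b → Disjoint S' b → w ⬝ᵥ udPt b = δP := by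
    intro b hSb hS'b
    rw [hwdot, hdiag_face b hSb hS'b, hev_face b hSb hS'b]
  -- validity of `w` on `COR(n)`
  have hgen : ∀ y ∈ Set.range (fun a : Cube n => vecOuter n (bvec a)), w ⬝ᵥ y ≤ δP := by
    rintro _ ⟨a, rfl⟩
    have hpt : vecOuter n (bvec a) = udPt (Finset.univ.filter fun i => a i = true) := by
      unfold udPt
      congr 1
      funext i
      rw [udInd_apply]
      simp [bvec]
    show w ⬝ᵥ vecOuter n (bvec a) ≤ δP
    rw [hpt]
    exact hw_vert _
  have hwP : ∀ x ∈ corPolytope n, w ⬝ᵥ x ≤ δP := fun x hx =>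
    dot_le_of_mem_convexHull _ w δP hgen x hx
  -- (4) the face of `Q`: the top generators take at most `|T|` distinct values
  obtain ⟨j₀, -, hj₀⟩ :=
    Finset.exists_max_image Finset.univ (fun j => w ⬝ᵥ q j) Finset.univ_nonempty
  have hmax : ∀ j, w ⬝ᵥ q j ≤ w ⬝ᵥ q j₀ := fun j => hj₀ j (Finset.mem_univ j)
  set δQ := w ⬝ᵥ q j₀ with hδQ
  have hwQ : ∀ y ∈ Q, w ⬝ᵥ y ≤ δQ := fun y hy =>
    dot_le_of_mem_convexHull _ w δQ (by rintro _ ⟨j, rfl⟩; exact hmax j) y (hQ hy)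
  have hFG := h.face_add_face₁ w δP δQ hwP hwQ
  -- two top generators with the same label are equal
  have htop : ∀ j j', w ⬝ᵥ q j = δQ → w ⬝ᵥ q j' = δQ → π j = π j' → q j = q j' := by
    intro j j' hj hj' hπ
    obtain ⟨hpsi, hd⟩ := hwsep j j' (by rw [hj, hj'])
    exact hsep j j' hπ hpsi hd
  -- the finset of top values and its size
  let Top : Finset J := Finset.univ.filter fun j => w ⬝ᵥ q j = δQ
  let Vals : Finset (Fin (n * n) → ℝ) := Top.image q
  have hj₀Top : j₀ ∈ Top := Finset.mem_filter.2 ⟨Finset.mem_univ _, rfl⟩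
  have hVals_card : Vals.card ≤ Fintype.card T := by
    let φ : T → (Fin (n * n) → ℝ) := fun t =>
      if hx : ∃ j, j ∈ Top ∧ π j = t then q hx.choose else 0
    have hsub : Vals ⊆ (Top.image π).image φ := by
      intro v hv
      obtain ⟨j, hj, rfl⟩ := Finset.mem_image.1 hv
      refine Finset.mem_image.2 ⟨π j, Finset.mem_image.2 ⟨j, hj, rfl⟩, ?_⟩
      have hx : ∃ j', j' ∈ Top ∧ π j' = π j := ⟨j, hj, rfl⟩
      show (if hx : ∃ j', j' ∈ Top ∧ π j' = π j then q hx.choose else 0) = q j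
      rw [dif_pos hx]
      obtain ⟨hc1, hc2⟩ := hx.choose_spec
      exact htop _ _ (Finset.mem_filter.1 hc1).2 (Finset.mem_filter.1 hj).2 hc2
    calc Vals.card ≤ ((Top.image π).image φ).card := Finset.card_le_card hsub
      _ ≤ (Top.image π).card := Finset.card_image_le
      _ ≤ (Finset.univ : Finset T).card := Finset.card_le_card (Finset.subset_univ _)
      _ = Fintype.card T := Finset.card_univ
  haveI : Nonempty ↥Vals := ⟨⟨q j₀, Finset.mem_image.2 ⟨j₀, hj₀Top, rfl⟩⟩⟩
  have hQface : Q ∩ {y | w ⬝ᵥ y = δQ} ⊆ convexHull ℝ (Set.range fun v : ↥Vals => (v.1 : Fin (n * n) → ℝ)) := by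
    rintro y ⟨hy, hyw⟩
    have hy' := mem_convexHull_maximisers q w δQ hmax (hQ hy) hyw
    refine convexHull_mono ?_ hy'
    rintro _ ⟨j, rfl⟩
    have hjT : j.1 ∈ Top := Finset.mem_filter.2 ⟨Finset.mem_univ _, j.2⟩
    exact ⟨⟨q j.1, Finset.mem_image.2 ⟨j.1, hjT, rfl⟩⟩, rfl⟩
  have hVals_mem : ∀ v : ↥Vals, (v.1 : Fin (n * n) → ℝ) ∈ Q ∩ {y | w ⬝ᵥ y = δQ} := by
    intro v
    obtain ⟨j, hj, hjv⟩ := Finset.mem_image.1 v.2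
    rw [← hjv]
    exact ⟨hq j, (Finset.mem_filter.1 hj).2⟩
  -- (5) the unique-disjointness data of the face, indexed by subsets of `Fin m`
  let B : Finset (Fin m) → Finset (Fin n) := fun b' => S ∪ b'.map e
  let A : Finset (Fin m) → Finset (Fin n) := fun a' => a'.map e
  have hAB : ∀ a' b', (A a' ∩ B b').card = (a' ∩ b').card := by
    intro a' b'
    have h1 : A a' ∩ B b' = (a' ∩ b').map e := by
      ext i
      simp only [A, B, Finset.mem_inter, Finset.mem_union, Finset.mem_map]
      constructor
      · rintro ⟨⟨x, hx, rfl⟩, h2 | ⟨y, hy, hxy⟩⟩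
        · exact absurd h2 (heS x)
        · have hyx : y = x := e.injective hxy
          subst hyx
          exact ⟨y, ⟨hx, hy⟩, rfl⟩
      · rintro ⟨x, ⟨hxa, hxb⟩, rfl⟩
        exact ⟨⟨x, hxa, rfl⟩, Or.inr ⟨x, hxb, rfl⟩⟩
    rw [h1, Finset.card_map]
  have hBface : ∀ b', S ⊆ B b' ∧ Disjoint S' (B b') := by
    intro b'
    refine ⟨Finset.subset_union_left, ?_⟩
    rw [Finset.disjoint_union_right]
    refine ⟨hSS'.symm, ?_⟩
    rw [Finset.disjoint_left]
    intro i hiS' hi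
    obtain ⟨x, -, rfl⟩ := Finset.mem_map.1 hi
    exact heS' x hiS'
  have key := three_pow_le_of_add (α := Fin m) hFG (fun b' => udPt (B b'))
    (fun b' => ⟨pt_mem _, hw_face _ (hBface b').1 (hBface b').2⟩) (fun a' => udRow (A a'))
    (fun _ => 1) (fun a' x hx => cc_valid (A a') x hx.1) ?_ ?_
    (fun v : ↥Vals => (v.1 : Fin (n * n) → ℝ)) hVals_mem hQface
  · rw [Fintype.card_fin, Fintype.card_coe] at key
    calc 3 ^ m ≤ Vals.card * (r + 1) * 2 ^ m := key
      _ ≤ Fintype.card T * (r + 1) * 2 ^ m :=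
          Nat.mul_le_mul_right _ (Nat.mul_le_mul_right _ hVals_card)
  · intro a' b' hlt hone
    have := slack (A a') (B b')
    rw [hAB, hone] at this
    norm_num at this
    linarith
  · intro a' b' hab
    have := slack (A a') (B b')
    rw [hAB, Finset.disjoint_iff_inter_eq_empty.1 hab, Finset.card_empty] at this
    norm_num at this
    linarith

/-! ## §2 The PARALLEL-FLATS RUNG -/

/-- ★★ **PARALLEL-FLATS RUNG (PROVED, unconditional):** if `COR(n) + conv{q j}` has an extended formulation of size `r` and the
generators lie on `|T|` parallel translates of a direction space `V` (`q j − q j' ∈ V` whenever `π j = π j'`), then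
`3^{n − dim V} ≤ |T| · (r + 1) · 2^{n − dim V}`.  `V = ⊥`: PROP A (`…corPolytope_add_hull_three_pow_le`).  `|T| = 1`: the DIMENSION
RUNG (`…corPolytope_add_three_pow_le_of_finrank`). [cite: FioriniEtAl2015, Thm. 7] [cite: KaibelWeltge2014, Thm. 1] -/
theorem corPolytope_add_three_pow_le_of_flats {n r : ℕ} {J T : Type} [Fintype J] [Nonempty J] [DecidableEq J]
    [Fintype T] [DecidableEq T]
    (q : J → (Fin (n * n) → ℝ)) (π : J → T) (V : Submodule ℝ (Fin (n * n) → ℝ))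
    (hV : ∀ j j', π j = π j' → q j - q j' ∈ V)
    (h : HasEFOfSize (corPolytope n + convexHull ℝ (Set.range q)) r) :
    3 ^ (n - Module.finrank ℝ ↥V) ≤ Fintype.card T * (r + 1) * 2 ^ (n - Module.finrank ℝ ↥V) := by
  classical
  obtain ⟨A', hcard, hA'⟩ := faceKer_flag_iterate V (Module.finrank ℝ ↥V) ∅
    (Submodule.finrank_mono inf_le_left)
  have hsep : ∀ j j', π j = π j' → (∀ t, psi A' ∅ t ⬝ᵥ (q j - q j') = 0) →
      diagDir A' ∅ ⬝ᵥ (q j - q j') = 0 → q j = q j' := by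
    intro j j' hπ ht _
    have hK : q j - q j' ∈ faceKer A' := ht
    have hmem' : q j - q j' ∈ V ⊓ faceKer A' := ⟨hV j j' hπ, hK⟩
    rw [hA', Submodule.mem_bot] at hmem'
    exact sub_eq_zero.1 hmem'
  have hR : (A'ᶜ).card = n - A'.card := by rw [Finset.card_compl, Fintype.card_fin]
  let e : Fin (n - A'.card) ↪ Fin n := ((A'ᶜ).orderEmbOfFin hR).toEmbedding
  have he : ∀ i, e i ∉ A' := fun i => Finset.mem_compl.1 (Finset.orderEmbOfFin_mem _ hR i)
  have hrung := corPolytope_add_genericFace_three_pow_le_card h q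
    (fun j => subset_convexHull ℝ _ (Set.mem_range_self j)) subset_rfl π A' ∅
    (Finset.disjoint_empty_right A') e he (fun i => by simp) hsep
  simp only [Finset.card_empty, zero_add] at hcard
  exact three_two_descend (by omega) hrung

/-- ★★ **PARALLEL-FLATS RUNG in the route's graph currency `COR(K_h) = corPolytopeGraph ⊤`** (the currency of `CorMinkowskiHard`,
of AFHMS's located clique face and of the transports): for every finite family `q` labelled by `π : J → T` with `q j − q j' ∈ V`
whenever `π j = π j'`, `3^{h − dim V} ≤ |T| · (r + 1) · 2^{h − dim V}`. [cite: KaibelWeltge2014, Thm. 1] -/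
theorem corPolytopeGraph_top_add_hull_three_pow_le_of_flats {h r : ℕ} {J T : Type} [Fintype J] [Nonempty J]
    [DecidableEq J] [Fintype T] [DecidableEq T]
    (q : J → (Fin h × Fin h → ℝ)) (π : J → T) (V : Submodule ℝ (Fin h × Fin h → ℝ))
    (hV : ∀ j j', π j = π j' → q j - q j' ∈ V)
    (hyp : HasEFOfSize (corPolytopeGraph (⊤ : SimpleGraph (Fin h)) + convexHull ℝ (Set.range q)) r) :
    3 ^ (h - Module.finrank ℝ ↥V) ≤ Fintype.card T * (r + 1) * 2 ^ (h - Module.finrank ℝ ↥V) := by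
  let e : (Fin h × Fin h → ℝ) ≃ₗ[ℝ] (Fin (h * h) → ℝ) :=
    LinearEquiv.funCongrLeft ℝ ℝ (finProdFinEquiv (m := h) (n := h)).symm
  have himg : e '' (corPolytopeGraph (⊤ : SimpleGraph (Fin h)) + convexHull ℝ (Set.range q)) =
      corPolytope h + convexHull ℝ (Set.range (e ∘ q)) := by
    rw [Set.image_add, Literature.Barriers.PneNP.corPolytope_eq_image_corPolytopeGraph_top, Set.range_comp]
    congr 1
    exact e.toLinearMap.image_convexHull (Set.range q)
  have h' : HasEFOfSize (corPolytope h + convexHull ℝ (Set.range (e ∘ q))) r := by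
    rw [← himg]; exact (HasEFOfSize.image_linearEquiv_iff e).2 hyp
  have hV' : ∀ j j', π j = π j' → (e ∘ q) j - (e ∘ q) j' ∈ V.map (e : (Fin h × Fin h → ℝ) →ₗ[ℝ] (Fin (h * h) → ℝ)) := by
    intro j j' hπ
    refine ⟨q j - q j', hV j j' hπ, ?_⟩
    simp [map_sub]
  have hdim : Module.finrank ℝ ↥(V.map (e : (Fin h × Fin h → ℝ) →ₗ[ℝ] (Fin (h * h) → ℝ))) =
      Module.finrank ℝ ↥V := LinearEquiv.finrank_map_eq e _
  have := corPolytope_add_three_pow_le_of_flats (e ∘ q) π _ hV' h'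
  rwa [hdim] at this

/-- the sum of a few-generated family and a second family lies on few parallel flats: for `q (i, j) = q₁ i + q₂ j`, the label
`π = Prod.fst` and the direction space `V = vectorSpan (range q₂)` qualify. [folklore] -/
theorem add_flats {ι I₁ I₂ : Type} (q₁ : I₁ → ι → ℝ) (q₂ : I₂ → ι → ℝ) (a b : I₁ × I₂) (hab : a.1 = b.1) :
    (q₁ a.1 + q₂ a.2) - (q₁ b.1 + q₂ b.2) ∈ vectorSpan ℝ (Set.range q₂) := by
  rw [hab, add_sub_add_left_eq_sub]
  have := vsub_mem_vectorSpan ℝ (Set.mem_range_self (f := q₂) a.2) (Set.mem_range_self (f := q₂) b.2)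
  rwa [vsub_eq_sub] at this

/-- ★★ **SUM OF A FEW-GENERATED AND A LOW-DIMENSIONAL PASSENGER (PROVED):** for `Q = conv{q₁ i} + conv{q₂ j}` an extended
formulation of `COR(K_h) + Q` of size `r` forces `3^{h − d₂} ≤ |I₁| · (r + 1) · 2^{h − d₂}`, `d₂ = dim aff {q₂ j}` — neither PROP A
(`|I₁|·#vert conv q₂` generators) nor the DIMENSION RUNG (`dim ≤ |I₁| − 1 + d₂`) gives this. [cite: KaibelWeltge2014, Thm. 1] -/
theorem corPolytopeGraph_top_add_add_three_pow_le {h r : ℕ} {I₁ I₂ : Type} [Fintype I₁] [Nonempty I₁] [DecidableEq I₁]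
    [Fintype I₂] [Nonempty I₂] [DecidableEq I₂]
    (q₁ : I₁ → (Fin h × Fin h → ℝ)) (q₂ : I₂ → (Fin h × Fin h → ℝ))
    (hyp : HasEFOfSize (corPolytopeGraph (⊤ : SimpleGraph (Fin h)) +
      (convexHull ℝ (Set.range q₁) + convexHull ℝ (Set.range q₂))) r) :
    3 ^ (h - adim (Set.range q₂)) ≤ Fintype.card I₁ * (r + 1) * 2 ^ (h - adim (Set.range q₂)) := by
  classical
  have hrange : Set.range q₁ + Set.range q₂ = Set.range fun ij : I₁ × I₂ => q₁ ij.1 + q₂ ij.2 := by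
    ext y
    simp only [Set.mem_add, Set.mem_range]
    constructor
    · rintro ⟨_, ⟨i, rfl⟩, _, ⟨j, rfl⟩, rfl⟩
      exact ⟨(i, j), rfl⟩
    · rintro ⟨ij, rfl⟩
      exact ⟨q₁ ij.1, ⟨ij.1, rfl⟩, q₂ ij.2, ⟨ij.2, rfl⟩, rfl⟩
  have hsum : convexHull ℝ (Set.range q₁) + convexHull ℝ (Set.range q₂) =
      convexHull ℝ (Set.range fun ij : I₁ × I₂ => q₁ ij.1 + q₂ ij.2) := by
    rw [← convexHull_add, hrange]
  rw [hsum] at hyp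
  exact corPolytopeGraph_top_add_hull_three_pow_le_of_flats (fun ij : I₁ × I₂ => q₁ ij.1 + q₂ ij.2) Prod.fst
    (vectorSpan ℝ (Set.range q₂)) (fun a b hab => add_flats q₁ q₂ a b hab) hyp

end FewFlats

end Summit.ValiantsHypothesis.ValiantsHypothesis.Theorems.FifoMatching

end
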